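import Literature.AnabelianGeometry.SemiGraphs.PullbackFunctor
import Literature.AnabelianGeometry.SemiGraphs.BranchSubgroupLemmas

/-!
# Basepoint changes along a morphism of semi-graphs of anabelioids are inner ([SemiAnbd] §2)

Mochizuki, *Semi-graphs of anabelioids*, Publ. RIMS **42** (2006), §2, Definition 2.1 p. 23 and
Remark 2.2.1 p. 24: the homomorphisms `Π_{v′} → Π_v → Π_𝒢` and `Π_{v′} → Π_{𝒢′} → Π_𝒢` attached to a
morphism `φ : 𝒢′ → 𝒢` and a vertex `v′` over `v` are "natural OUTER homomorphisms" — any two ways of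
choosing the basepoints and transports give homomorphisms that differ by an INNER automorphism of
`Π_𝒢` [cite: MochizukiSemiAnbd2006, Rem. 2.2.1 p.24].  Proof-only bookkeeping (cell abc-iut, layer
L3, row F-1477 / [SemiAnbd] Rmk. 2.10.1, sub-node (L4) of `LevelEdgeSeparation`: the HOM-LEVEL form of
the vertex dictionary (D2), needed to locate the transported branch groups of a covering inside
`Π_𝒢`; seat abc-iut-L3-t12):

* `Hom.exists_conj_vertexTransport` — for `φ : 𝒢′ → 𝒢`, vertices `w′, v′` of `𝒢′` with basepoints
  `F″, F′`, a transport `α′ : ρ′_{w′} ⋙ F″ ≅ ρ′_{v′} ⋙ F′` in `B(𝒢′)`, identifications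
  `e″ : φ_{w′}^* ⋙ F″ ≅ F₂`, `e′ : φ_{v′}^* ⋙ F′ ≅ F` with basepoints of `𝒢_{φ w′}`, `𝒢_{φ v′}`, and a
  transport `α : ρ_{φ w′} ⋙ F₂ ≅ ρ_{φ v′} ⋙ F` in `B(𝒢)`: the two composite homomorphisms
  `Π_{w′} → Π_𝒢 = Aut(ρ_{φ v′} ⋙ F)` — through `Π_{𝒢′}` (transport `α′`, then `ι = π₁(φ^*)` at `v′`)
  and through `Π_{φ w′}` (local `π₁(φ_{w′}^*)`, then `Π_{φ w′} → Π_𝒢`, transport `α`) — are CONJUGATE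
  by an explicit element of `Π_𝒢` (the composite of the two transports).

No statement here takes a side on any disputed claim; nothing about [IUTchIII] Cor. 3.12.
-/

namespace Literature.AnabelianGeometry.SemiGraphs

open CategoryTheory CategoryTheory.PreGaloisCategory
open Literature.AnabelianGeometry.Anabelioids

universe v₁ u₁ u w

namespace SemiGraphOfAnabelioids

variable {𝒢 𝒢' : SemiGraphOfAnabelioids.{v₁, u₁, u}}

/-- Two transports `θ_A, θ_B : X ≅ Y` induce conjugate isomorphisms `Aut X ≃* Aut Y`: they differ by
conjugation by `θ_B⁻¹ ≫ θ_A ∈ Aut Y`. [cite: MochizukiSemiAnbd2006, Rem. 2.2.1 p.24] -/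
theorem autMulEquivOfIso_eq_conj {C : Type*} [Category C] {X Y : C} (θA θB : X ≅ Y) (z : Aut X)
    (g : Aut Y) (hg : g = θB.symm ≪≫ θA) :
    Aut.autMulEquivOfIso θA z = g * Aut.autMulEquivOfIso θB z * g⁻¹ := by
  subst hg
  apply Iso.ext
  simp [Aut.autMulEquivOfIso, Aut.Aut_mul_def, Aut.Aut_inv_def]

/-- **Basepoint changes are inner.**  See the module docstring: the homomorphism
`Π_{w′} → Π_{𝒢′} →(α′)→ Π_{𝒢′} →ι→ Π_𝒢` and the homomorphism
`Π_{w′} → Π_{φ w′} → Π_𝒢 →(α)→ Π_𝒢` differ by conjugation by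
`g := (ρ ◁ e″ ≫ α)⁻¹ ≫ (φ^* ◁ α′ ≫ ρ ◁ e′) ∈ Aut(ρ_{φ v′} ⋙ F) = Π_𝒢`.
[cite: MochizukiSemiAnbd2006, Rem. 2.2.1 p.24] -/
theorem Hom.exists_conj_vertexTransport (φ : Hom 𝒢' 𝒢) (w' v' : 𝒢'.graph.Vertex)
    (F'' : 𝒢'.V w' ⥤ FintypeCat.{w}) (F' : 𝒢'.V v' ⥤ FintypeCat.{w})
    (α' : 𝒢'.ρ w' ⋙ F'' ≅ 𝒢'.ρ v' ⋙ F')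
    (F₂ : 𝒢.V (φ.base.vertexMap w') ⥤ FintypeCat.{w}) (e'' : (φ.φV w').pullback ⋙ F'' ≅ F₂)
    (F : 𝒢.V (φ.base.vertexMap v') ⥤ FintypeCat.{w}) (e' : (φ.φV v').pullback ⋙ F' ≅ F)
    (α : 𝒢.ρ (φ.base.vertexMap w') ⋙ F₂ ≅ 𝒢.ρ (φ.base.vertexMap v') ⋙ F) :
    ∃ g : 𝒢.Pi (φ.base.vertexMap v') F, ∀ y : 𝒢'.PiV w' F'',
      Aut.autMulEquivOfIso (Functor.isoWhiskerLeft (𝒢.ρ (φ.base.vertexMap v')) e')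
          (pi1Map φ.pullbackFunctor (𝒢'.ρ v' ⋙ F')
            (Aut.autMulEquivOfIso α' (𝒢'.piVToPi w' F'' y))) =
        g * Aut.autMulEquivOfIso α (𝒢.piVToPi (φ.base.vertexMap w') F₂
              (Aut.autMulEquivOfIso e'' (pi1Map (φ.φV w').pullback F'' y))) * g⁻¹ := by
  -- the two transports from `Θ := φ^* ⋙ ρ′_{w′} ⋙ F″ = ρ_{φ w′} ⋙ φ_{w′}^* ⋙ F″` to `ρ_{φ v′} ⋙ F`
  let θA : φ.pullbackFunctor ⋙ (𝒢'.ρ w' ⋙ F'') ≅ 𝒢.ρ (φ.base.vertexMap v') ⋙ F :=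
    Functor.isoWhiskerLeft φ.pullbackFunctor α' ≪≫
      Functor.isoWhiskerLeft (𝒢.ρ (φ.base.vertexMap v')) e'
  let θB : φ.pullbackFunctor ⋙ (𝒢'.ρ w' ⋙ F'') ≅ 𝒢.ρ (φ.base.vertexMap v') ⋙ F :=
    Functor.isoWhiskerLeft (𝒢.ρ (φ.base.vertexMap w')) e'' ≪≫ α
  refine ⟨θB.symm ≪≫ θA, fun y => ?_⟩
  -- both homomorphisms are transports (along `θ_A`, resp. `θ_B`) of `ι(y) ∈ Aut Θ`
  let z : Aut (φ.pullbackFunctor ⋙ (𝒢'.ρ w' ⋙ F'')) :=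
    pi1Map φ.pullbackFunctor (𝒢'.ρ w' ⋙ F'') (𝒢'.piVToPi w' F'' y)
  have hA : Aut.autMulEquivOfIso (Functor.isoWhiskerLeft (𝒢.ρ (φ.base.vertexMap v')) e')
      (pi1Map φ.pullbackFunctor (𝒢'.ρ v' ⋙ F')
        (Aut.autMulEquivOfIso α' (𝒢'.piVToPi w' F'' y))) = Aut.autMulEquivOfIso θA z := rfl
  have hB : Aut.autMulEquivOfIso α (𝒢.piVToPi (φ.base.vertexMap w') F₂
      (Aut.autMulEquivOfIso e'' (pi1Map (φ.φV w').pullback F'' y))) =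
        Aut.autMulEquivOfIso θB z := rfl
  rw [hA, hB]
  exact autMulEquivOfIso_eq_conj θA θB z _ rfl

end SemiGraphOfAnabelioids

end Literature.AnabelianGeometry.SemiGraphs
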